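import Summits.Ventures.HodgeRepro.Tier3PinningGlue
import Summits.Ventures.HodgeRepro.Tier3PadicCharacters

/-!
# Tier 3, T3.2 — R-B.4: the prescribed-branch input is needed on ONE line (re-basing the lines by the
«∃ branch» characters)
(seat t3-p3, gen 3)

Blind re-derivation cell `pub-hodge-repro`, Tier-3 seat `t3-p3` (route/TIER3.md v1.1 §3 row R-B, sub-row R-B.4
«complex placement»; paper: proofs/t3-p3/R2-PINNING-ADDENDUM-1.md §A10).

Setting (lead g111, INBOX L6576 (2)): the characters of the finite level group `Cl′_n = Δ × Γ_n` are the pairs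
`(δ, ν)` with `δ ∈ Δ̂` (the finitely many «branch» characters — the torsion of the tower) and `ν ∈ Ξ_𝔭` (the
degree-one tower family).  Finite Fourier inversion (tree `Tier3FourierInversion` / `Tier3FourierInversionChar`)
gives on each line only an «∃ branch» statement: SOME `(δ_j, ν_j)` has `L(1, λ_j δ_j ν_j) ≠ 0` with `δ_j`
UNCONTROLLED, while R-B asks for the trivial branch `δ = 1`.  §A10 observes that each `δ ∈ Δ̂` is an admissible
corner twist under the route's freedom (F1), so lines `0, 1, 2` may be RE-BASED to `λ_j δ_j`; N2 then FORCES the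
base of the fourth line to be `δ_0 δ_1 δ_2⁻¹` (`existsUnique_n2_extension`), and the chain «one value ⇒ Katz branch
element ≠ 0 ⇒ Weierstrass ⇒ cofinite» runs on the four re-based lines.  Hence R-B's four trivial-branch inputs are
implied by «∃ branch» on three lines plus ONE prescribed-branch value on the fourth.  This file types that count:

* `n2Rebase δ` — the N2-forced base vector `(δ_0, δ_1, δ_2, δ_0 δ_1 δ_2⁻¹)`; `n2Rebase_n2` (it is N2-admissible),
  `n2Rebase_unique` (the fourth base is forced), `n2Rebase_mem` (the forced fourth base is again a branch
  character);
* `n2_rebase_const` — the constant tower twist `ν` on top of the base vector is N2-admissible in `Δ̂ × Ξ`;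
* `four_line_pinning_of_rebase` — the hypotheses of `four_line_pinning_of_interpolation` for the four RE-BASED
  lines, the one-value input `h0` replaced by one value on each of lines `0, 1, 2` at the given branches and ONE
  value on line `3` at the forced branch: infinitely many common good `ν`, and N2 for `(n2Rebase δ j, ν)_j`;
* `four_line_pinning_of_exists_branch` — the same with the «∃ branch» hypothesis as printed (the branches of lines
  `0, 1, 2` existentially quantified and the fourth line's input asked only at the branch N2 dictates), the base
  vector produced in the conclusion;
* `four_line_pinning_of_exists_branch_padic` — the «∃ branch» form on Mathlib's continuous characters of `ℤ_p`
  (the dictionary of `Tier3PadicCharacters`).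

HONESTY.  Everything about Hecke characters, `L`-values, the Katz measure, Fourier inversion and equidistribution
stays in the HYPOTHESES (`hL`, `h012`, `h3`, `hε`); the prescribed-branch input on the fourth line is NOT removed,
only moved to one line and pinned to the branch N2 dictates.  TIER3.md §3 R-B's verdict (DECLARED, not closed in
print) is unchanged.  Nothing here says anything about the status of the Hodge conjecture for CM abelian varieties,
which is NOT proved.
-/

set_option autoImplicit false

namespace Summit.Ventures.HodgeRepro.T3.R2Pinning

open PowerSeries

section Rebase

variable {D : Type*} [CommGroup D]

/-- **The N2-forced base vector.** Three branch characters `δ_0, δ_1, δ_2` on lines `0, 1, 2` and the fourth base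
`δ_0 δ_1 δ_2⁻¹` that N2 (`η 0 * η 1 = η 2 * η 3`) dictates for line `3`. -/
def n2Rebase (δ : Fin 3 → D) : Fin 4 → D := ![δ 0, δ 1, δ 2, δ 0 * δ 1 * (δ 2)⁻¹]

/-- Line `0` keeps its branch. -/
@[simp] theorem n2Rebase_zero (δ : Fin 3 → D) : n2Rebase δ 0 = δ 0 := rfl

/-- Line `1` keeps its branch. -/
@[simp] theorem n2Rebase_one (δ : Fin 3 → D) : n2Rebase δ 1 = δ 1 := rfl

/-- Line `2` keeps its branch. -/
@[simp] theorem n2Rebase_two (δ : Fin 3 → D) : n2Rebase δ 2 = δ 2 := rfl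

/-- Line `3` gets the forced branch `δ_0 δ_1 δ_2⁻¹`. -/
@[simp] theorem n2Rebase_three (δ : Fin 3 → D) : n2Rebase δ 3 = δ 0 * δ 1 * (δ 2)⁻¹ := rfl

/-- The base vector extends the three given branches. -/
theorem n2Rebase_castSucc (δ : Fin 3 → D) (i : Fin 3) : n2Rebase δ (Fin.castSucc i) = δ i := by
  fin_cases i <;> rfl

/-- The base vector is N2-admissible: `δ_0 δ_1 = δ_2 (δ_0 δ_1 δ_2⁻¹)`. -/
theorem n2Rebase_n2 (δ : Fin 3 → D) : n2Rebase δ 0 * n2Rebase δ 1 = n2Rebase δ 2 * n2Rebase δ 3 := by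
  rw [n2Rebase_zero, n2Rebase_one, n2Rebase_two, n2Rebase_three, mul_comm (δ 2) _, inv_mul_cancel_right]

/-- **The fourth base is forced.** Every N2-admissible vector extending the three branches is `n2Rebase δ`
(`existsUnique_n2_extension`, tree `Tier3R2Pinning`). -/
theorem n2Rebase_unique (δ : Fin 3 → D) (η : Fin 4 → D) (hη : ∀ i : Fin 3, η (Fin.castSucc i) = δ i)
    (hn : η 0 * η 1 = η 2 * η 3) : η = n2Rebase δ := by
  obtain ⟨_, -, huniq⟩ := existsUnique_n2_extension δ
  rw [huniq η ⟨hη, hn⟩, huniq (n2Rebase δ) ⟨n2Rebase_castSucc δ, n2Rebase_n2 δ⟩]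

/-- If the three branches lie in a subgroup (the branch characters `Δ̂` inside all finite-order characters), so does
the forced fourth: the re-based fourth line is again an (F1)-admissible corner twist. -/
theorem n2Rebase_mem (S : Subgroup D) (δ : Fin 3 → D) (h : ∀ i, δ i ∈ S) (j : Fin 4) :
    n2Rebase δ j ∈ S := by
  fin_cases j
  · exact h 0
  · exact h 1
  · exact h 2
  · exact S.mul_mem (S.mul_mem (h 0) (h 1)) (S.inv_mem (h 2))

variable {Ξ : Type*} [CommMonoid Ξ]

/-- **The constant tower twist on top of the base vector is N2-admissible** in `Δ̂ × Ξ`: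
`(δ_0, ν)(δ_1, ν) = (δ_2, ν)(δ_0 δ_1 δ_2⁻¹, ν)`. -/
theorem n2_rebase_const (δ : Fin 3 → D) (ν : Ξ) :
    ((n2Rebase δ 0, ν) : D × Ξ) * (n2Rebase δ 1, ν) = (n2Rebase δ 2, ν) * (n2Rebase δ 3, ν) := by
  rw [Prod.mk_mul_mk, Prod.mk_mul_mk, n2Rebase_n2]

end Rebase

section Glue

variable {A : Type*} [CommRing A] [IsDomain A] [IsDiscreteValuationRing A]
  [IsAdicComplete (IsLocalRing.maximalIdeal A) A] [UniformSpace A] [IsUniformAddGroup A]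
  [IsTopologicalRing A]
variable {B : Type*} [CommRing B] [IsDomain B] [UniformSpace B] [IsUniformAddGroup B] [T2Space B]
  [CompleteSpace B] [IsTopologicalRing B] [IsLinearTopology B B] [Algebra A B] [ContinuousSMul A B]
variable {D : Type*} [CommGroup D] {Ξ : Type*} [CommMonoid Ξ]

/-- **The count on given branches (§A10).** `L j (δ, ν)` = the `j`-th central value at the character `(δ, ν)` of
`Δ × Γ_n`; the four lines are RE-BASED by `n2Rebase δ` (interpolation data `hL` on the re-based lines, signs `hε`);
one value on line `i ∈ {0, 1, 2}` at its branch `δ i`, and ONE value on line `3` at the forced branch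
`δ_0 δ_1 δ_2⁻¹`.  Then infinitely many tower twists `ν` are good for all four re-based lines, and every such
`(n2Rebase δ j, ν)_j` satisfies N2. -/
theorem four_line_pinning_of_rebase [Infinite Ξ] (hinj : Function.Injective (algebraMap A B))
    (ζ : Ξ → B) (hζ : Function.Injective ζ) (hev : ∀ ν, HasEval (ζ ν - 1))
    (δ : Fin 3 → D) (G : Fin 4 → PowerSeries A)
    (L : Fin 4 → D × Ξ → B) (u : Fin 4 → Ξ → B) (hu : ∀ j ν, u j ν ≠ 0)
    (hL : ∀ j ν, L j (n2Rebase δ j, ν) = u j ν * aeval (hev ν) (G j))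
    (h012 : ∀ i : Fin 3, ∃ ν, L (Fin.castSucc i) (δ i, ν) ≠ 0)
    (h3 : ∃ ν, L 3 (δ 0 * δ 1 * (δ 2)⁻¹, ν) ≠ 0)
    (ε : Fin 4 → D × Ξ → ℤˣ) (hε : ∀ j, {ν | ε j (n2Rebase δ j, ν) ≠ 1}.Finite) :
    {ν : Ξ | ∀ j, L j (n2Rebase δ j, ν) ≠ 0 ∧ ε j (n2Rebase δ j, ν) = 1}.Infinite ∧
      ∀ ν : Ξ, ((n2Rebase δ 0, ν) : D × Ξ) * (n2Rebase δ 1, ν) =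
        (n2Rebase δ 2, ν) * (n2Rebase δ 3, ν) := by
  refine ⟨?_, fun ν => n2_rebase_const δ ν⟩
  have h0 : ∀ j : Fin 4, ∃ ν₀, L j (n2Rebase δ j, ν₀) ≠ 0 := by
    intro j
    fin_cases j
    · exact h012 0
    · exact h012 1
    · exact h012 2
    · exact h3
  exact infinite_common_good_of_interpolation (B := B) hinj ζ hζ hev G
    (fun j ν => L j (n2Rebase δ j, ν)) u hu hL h0 (fun j ν => ε j (n2Rebase δ j, ν)) hε

/-- **The count with «∃ branch» as printed.** Interpolation data and sign cofiniteness on EVERY re-based line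
`(j, d)` (the branch element `G j d` of `λ_j d`); «∃ branch» on lines `0, 1, 2` (the branches `d` UNCONTROLLED —
finite Fourier inversion from one non-vanishing toric value); and the prescribed-branch input on line `3`, asked
only at the branch `d_0 d_1 d_2⁻¹` that N2 dictates for the branches the first three lines produced.  Then there is a
base vector `δ` with infinitely many common good tower twists `ν` on the four re-based lines, N2 holding for every
`(n2Rebase δ j, ν)_j`. -/
theorem four_line_pinning_of_exists_branch [Infinite Ξ] (hinj : Function.Injective (algebraMap A B))
    (ζ : Ξ → B) (hζ : Function.Injective ζ) (hev : ∀ ν, HasEval (ζ ν - 1))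
    (G : Fin 4 → D → PowerSeries A)
    (L : Fin 4 → D × Ξ → B) (u : Fin 4 → D → Ξ → B) (hu : ∀ j d ν, u j d ν ≠ 0)
    (hL : ∀ j d ν, L j (d, ν) = u j d ν * aeval (hev ν) (G j d))
    (h012 : ∀ i : Fin 3, ∃ d ν, L (Fin.castSucc i) (d, ν) ≠ 0)
    (h3 : ∀ δ : Fin 3 → D, (∀ i, ∃ ν, L (Fin.castSucc i) (δ i, ν) ≠ 0) →
      ∃ ν, L 3 (δ 0 * δ 1 * (δ 2)⁻¹, ν) ≠ 0)
    (ε : Fin 4 → D × Ξ → ℤˣ) (hε : ∀ j d, {ν | ε j (d, ν) ≠ 1}.Finite) :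
    ∃ δ : Fin 3 → D,
      {ν : Ξ | ∀ j, L j (n2Rebase δ j, ν) ≠ 0 ∧ ε j (n2Rebase δ j, ν) = 1}.Infinite ∧
        ∀ ν : Ξ, ((n2Rebase δ 0, ν) : D × Ξ) * (n2Rebase δ 1, ν) =
          (n2Rebase δ 2, ν) * (n2Rebase δ 3, ν) := by
  choose d ν hdν using h012
  refine ⟨d, four_line_pinning_of_rebase (B := B) hinj ζ hζ hev d (fun j => G j (n2Rebase d j)) L
    (fun j => u j (n2Rebase d j)) (fun j => hu j _) (fun j => hL j _) (fun i => ⟨ν i, hdν i⟩)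
    (h3 d fun i => ⟨ν i, hdν i⟩) ε (fun j => hε j _)⟩

end Glue

section Padic

variable {p : ℕ} [Fact p.Prime]
variable {A : Type*} [CommRing A] [IsDomain A] [IsDiscreteValuationRing A]
  [IsAdicComplete (IsLocalRing.maximalIdeal A) A] [UniformSpace A] [IsUniformAddGroup A]
  [IsTopologicalRing A]
variable {B : Type*} [NormedCommRing B] [IsDomain B] [Algebra ℤ_[p] B] [IsBoundedSMul ℤ_[p] B]
  [IsUltrametricDist B] [CompleteSpace B] [IsLinearTopology B B] [Algebra A B] [ContinuousSMul A B]
variable {D : Type*} [CommGroup D]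

/-- **The «∃ branch» count with the dictionary discharged.** The tower twists are Mathlib's continuous characters
`κ` of `ℤ_p` (`= Γ_𝔭` on a degree-one line) with values in `B`, the evaluation point `κ 1 − 1`
(`Tier3PadicCharacters`); the branches `d ∈ Δ̂` a commutative group `D`; the central values `L j (d, κ)`.  «∃ branch»
on lines `0, 1, 2` and the prescribed-branch input on line `3` at the forced branch give a base vector `δ`, infinitely
many common good characters `κ`, and N2 for `(n2Rebase δ j, κ)_j` in `D × AddChar ℤ_[p] B`. -/
theorem four_line_pinning_of_exists_branch_padic (hinj : Function.Injective (algebraMap A B))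
    (hp0 : (p : B) ≠ 0) (hpu : ¬ IsUnit (p : B)) (hpt : IsTopologicallyNilpotent (p : B))
    (G : Fin 4 → D → PowerSeries A)
    (L : Fin 4 → D × {κ : AddChar ℤ_[p] B // Continuous κ} → B)
    (u : Fin 4 → D → {κ : AddChar ℤ_[p] B // Continuous κ} → B) (hu : ∀ j d κ, u j d κ ≠ 0)
    (hL : ∀ j d κ, L j (d, κ) = u j d κ * aeval (hasEval_eval_one_sub_one κ) (G j d))
    (h012 : ∀ i : Fin 3, ∃ d κ, L (Fin.castSucc i) (d, κ) ≠ 0)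
    (h3 : ∀ δ : Fin 3 → D, (∀ i, ∃ κ, L (Fin.castSucc i) (δ i, κ) ≠ 0) →
      ∃ κ, L 3 (δ 0 * δ 1 * (δ 2)⁻¹, κ) ≠ 0)
    (ε : Fin 4 → D × {κ : AddChar ℤ_[p] B // Continuous κ} → ℤˣ)
    (hε : ∀ j d, {κ | ε j (d, κ) ≠ 1}.Finite) :
    ∃ δ : Fin 3 → D,
      {κ : {κ : AddChar ℤ_[p] B // Continuous κ} |
        ∀ j, L j (n2Rebase δ j, κ) ≠ 0 ∧ ε j (n2Rebase δ j, κ) = 1}.Infinite ∧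
        ∀ κ : {κ : AddChar ℤ_[p] B // Continuous κ},
          ((n2Rebase δ 0, κ.1) : D × AddChar ℤ_[p] B) * (n2Rebase δ 1, κ.1) =
            (n2Rebase δ 2, κ.1) * (n2Rebase δ 3, κ.1) := by
  choose d κ hdκ using h012
  refine ⟨d, ?_, fun κ => n2_rebase_const d κ.1⟩
  have h0 : ∀ j : Fin 4, ∃ κ₀, L j (n2Rebase d j, κ₀) ≠ 0 := by
    intro j
    fin_cases j
    · exact ⟨κ 0, hdκ 0⟩
    · exact ⟨κ 1, hdκ 1⟩
    · exact ⟨κ 2, hdκ 2⟩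
    · exact h3 d fun i => ⟨κ i, hdκ i⟩
  exact infinite_common_good_of_padic_chars hinj hp0 hpu hpt (fun j => G j (n2Rebase d j))
    (fun j κ => L j (n2Rebase d j, κ)) (fun j => u j (n2Rebase d j)) (fun j => hu j _)
    (fun j => hL j _) h0 (fun j κ => ε j (n2Rebase d j, κ)) (fun j => hε j _)

end Padic


section ChainA

/-!
### v2 (t3-p3 g3, APPEND): the forced branch on ANY line

N2 (`η 0 * η 1 = η 2 * η 3`) is symmetric under the relabelings `0 ↔ 1`, `2 ↔ 3`, `(0,1) ↔ (2,3)`, so the line whose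
branch is FORCED may be any of the four.  This matters for R-B's placement (proofs/t3-p3/R2-PINNING-ADDENDUM-2.md §A13):
on a line of infinity type `Σ` (`κ_j = 0`) the printed chain A (Hsieh 2014 Thm A + Burungale–Hida 2017 Thm B +
Weierstrass) gives the value for EVERY branch `d` (the branch character only changes the prime-to-`p` conductor by
nothing), so such a line can absorb the forced branch, and «∃ branch» is needed only on the remaining lines.

* `n2Force j₀ d` — the vector `d` with its `j₀`-th entry replaced by the value N2 dictates; `n2Force_apply_ne`,
  `n2Force_n2`;
* `four_line_pinning_of_exists_branch_of_chainA` — one line `j₀` with a value on EVERY branch (chain A), «∃ branch» on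
  the other three ⇒ an N2-admissible branch vector with infinitely many common good tower twists.
-/

variable {D : Type*} [CommGroup D]

/-- **The N2-forced entry at position `j₀`.**  `n2Force j₀ d` agrees with `d` off `j₀` and carries at `j₀` the unique
value making the vector N2-admissible (`d₂ d₃ d₁⁻¹`, `d₂ d₃ d₀⁻¹`, `d₀ d₁ d₃⁻¹`, `d₀ d₁ d₂⁻¹` for `j₀ = 0, 1, 2, 3`). -/
def n2Force (j₀ : Fin 4) (d : Fin 4 → D) : Fin 4 → D :=
  ![![d 2 * d 3 * (d 1)⁻¹, d 1, d 2, d 3],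
    ![d 0, d 2 * d 3 * (d 0)⁻¹, d 2, d 3],
    ![d 0, d 1, d 0 * d 1 * (d 3)⁻¹, d 3],
    ![d 0, d 1, d 2, d 0 * d 1 * (d 2)⁻¹]] j₀

/-- Off `j₀` the forced vector is `d`. -/
theorem n2Force_apply_ne (j₀ : Fin 4) (d : Fin 4 → D) {j : Fin 4} (h : j ≠ j₀) : n2Force j₀ d j = d j := by
  fin_cases j₀ <;> fin_cases j <;> first | exact absurd rfl h | rfl

/-- At `j₀` the forced vector carries the dictated value. -/
theorem n2Force_apply_self (j₀ : Fin 4) (d : Fin 4 → D) :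
    n2Force j₀ d j₀ = ![d 2 * d 3 * (d 1)⁻¹, d 2 * d 3 * (d 0)⁻¹, d 0 * d 1 * (d 3)⁻¹, d 0 * d 1 * (d 2)⁻¹] j₀ := by
  fin_cases j₀ <;> rfl

/-- **The forced vector is N2-admissible**, whichever line carries the forced entry. -/
theorem n2Force_n2 (j₀ : Fin 4) (d : Fin 4 → D) :
    n2Force j₀ d 0 * n2Force j₀ d 1 = n2Force j₀ d 2 * n2Force j₀ d 3 := by
  fin_cases j₀
  · show d 2 * d 3 * (d 1)⁻¹ * d 1 = d 2 * d 3
    rw [inv_mul_cancel_right]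
  · show d 0 * (d 2 * d 3 * (d 0)⁻¹) = d 2 * d 3
    rw [mul_comm (d 0) _, inv_mul_cancel_right]
  · show d 0 * d 1 = d 0 * d 1 * (d 3)⁻¹ * d 3
    rw [inv_mul_cancel_right]
  · show d 0 * d 1 = d 2 * (d 0 * d 1 * (d 2)⁻¹)
    rw [mul_comm (d 2) _, inv_mul_cancel_right]

/-- If the entries of `d` off `j₀` lie in a subgroup `S` (the branch characters), so does every entry of the forced
vector: the forced branch is again a branch character. -/
theorem n2Force_mem (S : Subgroup D) (j₀ : Fin 4) (d : Fin 4 → D) (h : ∀ j, j ≠ j₀ → d j ∈ S) (j : Fin 4) :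
    n2Force j₀ d j ∈ S := by
  by_cases hj : j = j₀
  · subst hj
    fin_cases j
    · exact S.mul_mem (S.mul_mem (h 2 (by decide)) (h 3 (by decide))) (S.inv_mem (h 1 (by decide)))
    · exact S.mul_mem (S.mul_mem (h 2 (by decide)) (h 3 (by decide))) (S.inv_mem (h 0 (by decide)))
    · exact S.mul_mem (S.mul_mem (h 0 (by decide)) (h 1 (by decide))) (S.inv_mem (h 3 (by decide)))
    · exact S.mul_mem (S.mul_mem (h 0 (by decide)) (h 1 (by decide))) (S.inv_mem (h 2 (by decide)))
  · rw [n2Force_apply_ne _ _ hj]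
    exact h j hj

variable {A : Type*} [CommRing A] [IsDomain A] [IsDiscreteValuationRing A]
  [IsAdicComplete (IsLocalRing.maximalIdeal A) A] [UniformSpace A] [IsUniformAddGroup A]
  [IsTopologicalRing A]
variable {B : Type*} [CommRing B] [IsDomain B] [UniformSpace B] [IsUniformAddGroup B] [T2Space B]
  [CompleteSpace B] [IsTopologicalRing B] [IsLinearTopology B B] [Algebra A B] [ContinuousSMul A B]
variable {Ξ : Type*} [CommMonoid Ξ]

/-- **One chain-A line absorbs the forced branch (§A13).**  Interpolation data and sign cofiniteness on every
re-based line `(j, d)`; on the line `j₀` a value on EVERY branch `d` (`hA` — what the printed chain A gives on a line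
of type `Σ`); on each other line `j ≠ j₀` «∃ branch» (`hB`).  Then there is an N2-admissible branch vector `δ`
(`δ 0 * δ 1 = δ 2 * δ 3`, with `δ j` the «∃ branch» witness for `j ≠ j₀`) and infinitely many tower twists `ν` good
for all four lines `(δ j, ν)` at once, every `(δ j, ν)_j` N2-admissible. -/
theorem four_line_pinning_of_exists_branch_of_chainA [Infinite Ξ]
    (hinj : Function.Injective (algebraMap A B))
    (ζ : Ξ → B) (hζ : Function.Injective ζ) (hev : ∀ ν, HasEval (ζ ν - 1))
    (G : Fin 4 → D → PowerSeries A)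
    (L : Fin 4 → D × Ξ → B) (u : Fin 4 → D → Ξ → B) (hu : ∀ j d ν, u j d ν ≠ 0)
    (hL : ∀ j d ν, L j (d, ν) = u j d ν * aeval (hev ν) (G j d))
    (j₀ : Fin 4) (hA : ∀ d, ∃ ν, L j₀ (d, ν) ≠ 0)
    (hB : ∀ j, j ≠ j₀ → ∃ d ν, L j (d, ν) ≠ 0)
    (ε : Fin 4 → D × Ξ → ℤˣ) (hε : ∀ j d, {ν | ε j (d, ν) ≠ 1}.Finite) :
    ∃ δ : Fin 4 → D, δ 0 * δ 1 = δ 2 * δ 3 ∧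
      {ν : Ξ | ∀ j, L j (δ j, ν) ≠ 0 ∧ ε j (δ j, ν) = 1}.Infinite ∧
        ∀ ν : Ξ, ((δ 0, ν) : D × Ξ) * (δ 1, ν) = (δ 2, ν) * (δ 3, ν) := by
  classical
  -- the «∃ branch» witnesses off `j₀` (any value at `j₀`, overwritten by the forced entry)
  have hB' : ∀ j, ∃ d ν, j ≠ j₀ → L j (d, ν) ≠ 0 := fun j => by
    by_cases hj : j = j₀
    · exact ⟨1, Classical.arbitrary Ξ, fun h => (h hj).elim⟩
    · obtain ⟨d, ν, hd⟩ := hB j hj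
      exact ⟨d, ν, fun _ => hd⟩
  choose d ν hdν using hB'
  refine ⟨n2Force j₀ d, n2Force_n2 j₀ d, ?_, fun ν' => ?_⟩
  · have h0 : ∀ j : Fin 4, ∃ ν₀, L j (n2Force j₀ d j, ν₀) ≠ 0 := by
      intro j
      by_cases hj : j = j₀
      · subst hj
        exact hA _
      · rw [n2Force_apply_ne _ _ hj]
        exact ⟨ν j, hdν j hj⟩
    exact infinite_common_good_of_interpolation (B := B) hinj ζ hζ hev (fun j => G j (n2Force j₀ d j))
      (fun j ν => L j (n2Force j₀ d j, ν)) (fun j => u j (n2Force j₀ d j)) (fun j => hu j _)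
      (fun j => hL j _) h0 (fun j ν => ε j (n2Force j₀ d j, ν)) (fun j => hε j _)
  · rw [Prod.mk_mul_mk, Prod.mk_mul_mk, n2Force_n2]

end ChainA


section ForcedSign

/-!
### v3 (t3-p3 g3, APPEND): the root number of the forced branch (ADDENDUM-2 §A14)

Paper input (§A14(a), the twist formula — NOT proved here): for a base character `χ_j′` unramified at the split
tower prime `𝔭` and a branch character `δ` (finite order, anticyclotomic, unramified outside `𝔭`),
`W(χ_j′ δ) = W(χ_j′) · δ(t_j)` with `t_j := [𝔣_j 𝔡]·[(−1)_𝔭]` an element of order `≤ 2` of the branch group.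
So on the kernel a branch `δ` is a character `Δ →* M` of the branch GROUP `Δ` (values in a commutative group `M`,
`ℂˣ` in practice), the root number of line `j` at branch `δ` is `w j * δ (t j)`, and the lemmas below are the pure
algebra of §A14(b): if the bases have sign `+1` and the «∃ branch» witnesses `δ_0, δ_1, δ_2` have sign `+1` on their
lines (`δ_j (t_j) = 1`), then the N2-forced branch `δ_0 δ_1 δ_2⁻¹` has, on line `3`, the sign
`∏_j δ_j (t_3 * t_j)` — the classes `t_3 t_j = [𝔣_3 𝔣_j⁻¹]` (different and tame part cancel) — which is `+1` when
the four classes coincide.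
-/

variable {Δ M : Type*} [CommGroup Δ] [CommGroup M]

/-- A character evaluated at an element of order `≤ 2` is its own inverse. -/
theorem map_inv_eq_self_of_sq_eq_one (δ : Δ →* M) {t : Δ} (ht : t ^ 2 = 1) : (δ t)⁻¹ = δ t := by
  have h : δ t * δ t = 1 := by rw [← map_mul, ← pow_two, ht, map_one]
  exact inv_eq_of_mul_eq_one_right h

/-- **The forced branch's sign (§A14(b)).**  Witnesses of sign `+1` on lines `0, 1, 2` (`δ i (t i) = 1`, the
bases normalised to `+1`); then the N2-forced branch `δ 0 * δ 1 * (δ 2)⁻¹` evaluated at `t 3` equals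
`δ 0 (t 3 * t 0) * δ 1 (t 3 * t 1) * δ 2 (t 3 * t 2)`. -/
theorem forced_branch_sign (δ : Fin 3 → (Δ →* M)) (t : Fin 4 → Δ) (ht : ∀ j, t j ^ 2 = 1)
    (hw : ∀ i : Fin 3, δ i (t (Fin.castSucc i)) = 1) :
    (δ 0 * δ 1 * (δ 2)⁻¹) (t 3) = δ 0 (t 3 * t 0) * δ 1 (t 3 * t 1) * δ 2 (t 3 * t 2) := by
  have h0 : δ 0 (t 0) = 1 := hw 0
  have h1 : δ 1 (t 1) = 1 := hw 1
  have h2 : δ 2 (t 2) = 1 := hw 2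
  simp only [MonoidHom.mul_apply, MonoidHom.inv_apply, map_mul, h0, h1, h2, mul_one]
  rw [map_inv_eq_self_of_sq_eq_one (δ 2) (ht 3)]

/-- **Equal classes ⇒ the forced line has sign `+1`** (§A14(c)(i): the four prime-to-`𝔭` conductors coincide). -/
theorem forced_branch_sign_of_eq (δ : Fin 3 → (Δ →* M)) (t : Fin 4 → Δ) (ht : ∀ j, t j ^ 2 = 1)
    (hw : ∀ i : Fin 3, δ i (t (Fin.castSucc i)) = 1) (heq : ∀ i : Fin 3, t (Fin.castSucc i) = t 3) :
    (δ 0 * δ 1 * (δ 2)⁻¹) (t 3) = 1 := by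
  rw [forced_branch_sign δ t ht hw]
  have e0 : t 0 = t 3 := heq 0
  have e1 : t 1 = t 3 := heq 1
  have e2 : t 2 = t 3 := heq 2
  rw [e0, e1, e2, ← pow_two, ht 3, map_one, map_one, map_one, mul_one, mul_one]

/-- **The forced branch, with its sign, as a value of `n2Rebase`**: the root number of line `j` at branch `δ` is
`w j * δ (t j)`; with all four base signs `+1` and witnesses of sign `+1`, the sign of line `3` at the forced branch
`n2Rebase δ 3` is the product of §A14(b). -/
theorem n2Rebase_three_sign (δ : Fin 3 → (Δ →* M)) (t : Fin 4 → Δ) (ht : ∀ j, t j ^ 2 = 1)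
    (hw : ∀ i : Fin 3, δ i (t (Fin.castSucc i)) = 1) :
    n2Rebase δ 3 (t 3) = δ 0 (t 3 * t 0) * δ 1 (t 3 * t 1) * δ 2 (t 3 * t 2) := by
  rw [n2Rebase_three]
  exact forced_branch_sign δ t ht hw

end ForcedSign

end Summit.Ventures.HodgeRepro.T3.R2Pinning
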